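import Summits.Ventures.CertifiedManyBodySolver.Downfold.BoxesNdNiO2M
import Summits.Ventures.CertifiedManyBodySolver.Downfold.BoxesNdNiO2ELadderC
import HarnessLib

/-!
# NdNiO₂ column M21 — ONE `U` LADDER UNDER TWO OBJECTS (the bridge `ndNiO2M_Uabs` ≡ `ndNiO2_oneBandU_hull`), THE TWO-OBJECT TABLE of box #20
# (object E `boxNdNiO2E_M21` vs object M `boxNdNiO2M_M21`, rows by value), and WHERE THE RESIDUAL CELL OF THE ROUTE «CovNdNiO2M21» SITS among them

Venture CertifiedManyBodySolver, cell `pub/hubbard-downfold` (MO-S1 ↔ S2 / obs seam; D-0154 (1)(C) COVERAGE, material (iii) NdNiO₂), seat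
hubbard-cov-ndnio2-unc-1 g2 (`prover-hubbard-cov-ndnio2-unc-1-g0-0`), lane «object M» (lead RULING R-ma, STATUS 2026-08-28T05:18Z; cross-read duty
«unc-1 reads unc-2's hull ends»); namespace `Summit.Ventures.CertifiedManyBodySolver.Downfold`. Everything cited BY NAME, nothing restated:
object M = `BoxesNdNiO2MLadder.lean` / `BoxesNdNiO2M.lean` (this lane: `ndNiO2M_Uabs` `[2.47, 3.2]` eV, `ndNiO2M_t` `[0.32, 0.433]` eV, `ndNiO2M_t_direct`
`[0.3689, 0.395]`, `ndNiO2M_UoverT` `[5.82, 9.8]`, `ndNiO2M_tp` `[−0.321, −0.160]`, `ndNiO2M_tpp` `[0.066, 0.167]`, `boxNdNiO2M_M21`, `boxS2Cell1NdNiO2M`);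
object E = unc-2's `BoxesNdNiO2ELadder{,B,C}.lean` (`ndNiO2_oneBandU_hull` `[247/100, 16/5]`, the v3 member census `ndNiO2_oneBandU_members_v3` =
§U-MEMBERS (1)–(8), `ndNiO2E_M21_U_mem_of_member_v3_div`, the route's residual corner cell typed as the sub-box `boxNdNiO2E_M21res`) and mod-1's
`BoxesNdNiO2E.lean` (`boxNdNiO2E_M21`: `U/t_eff [5, 17/2]`, `t′/t_eff [−23/50, −9/25]`, `t_eff [0.38, 0.49]` eV, `t″ = 0`, `n [0.852, 0.954]` SHARED with object M).

SOURCES: `router/BOXES/NdNiO2.md` sha16 `a02e41a7b870a485` (BOX OF RECORD #20) §OF-RECORD v1 (object-M rows), v1.1 («CONTAINMENT vs hubbard-fast S2 box #1 …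
holds for OBJECT M ONLY; object E is DISJOINT in tp/t»), v1.7 (R-ak: `U/t (E) = divPos(U_abs hull [2.47, 3.2] eV, t_eV (E) [0.38, 0.49])`), §R-ac FOLD v1
(`U/t (M) = divPos([2.47, 3.2], [0.3689, 0.395])` direct, ROW `[5.82, 9.8]`); route file `Theses/CovNdNiO2M21.lean` rev 0 (items stmt-Ventures-26751
`ResidualLowUSlab` `U/t ∈ [5, 13/2]` / stmt-Ventures-26752 `ResidualHighUSlab` `U/t ∈ [13/2, 17/2]`, both on `t′/t ∈ [−23/50, −11/25] × n ∈ [9/10, 477/500]`);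
hubbard-fast's solver domain 𝒟 = `|t′/t| ≤ 3/10` (DICTIONARY D0) is QUOTED as the literal `3/10`, not typed.

* §1 THE BRIDGE (promised STATUS l.5247): `ndNiO2M_Uabs.encl = ndNiO2_oneBandU_hull` — ONE rational interval, two names by object; every admitted `U` member
  of unc-2's v3 census is a member of the object-M `U_abs` entry and lands in BOTH typed quotient rows, each under ITS OWN object's hopping scale
  (`U/t (M)` over the MLWF direct hull, `U/t (E)` over the `t_eff` row).
* §2 THE TWO-OBJECT TABLE OF COLUMN M21, by value: `n` one shared decl; `U/t` rows overlap on `[5.82, 8.5]`; `t` rows overlap on `[0.38, 0.433]` eV; `t′/t` rows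
  DISJOINT (`−9/25 < −321/1000`, gap `0.039`) and `t″/t` DISJOINT (`0 < 0.066`) ⇒ as nine-coordinate boxes `boxNdNiO2E_M21 ∩ boxNdNiO2M_M21 = ∅`
  (§OF-RECORD v1.1 typed), although the `(U/t, n, t)` faces have common points.
* §3 THE ROUTE CELL'S OBJECT PLACEMENT: `boxNdNiO2E_M21res` (⊆ `boxNdNiO2E_M21`, unc-2) is `t′/t`-DISJOINT from the object-M box, lies OUTSIDE 𝒟 by `0.14`, and is
  DISJOINT from hubbard-fast's S2 cell #1 (`boxS2Cell1NdNiO2M` ⊆ object M) on TWO faces (`t′/t` and `n`: `177/200 < 9/10`); against the `U/t (M)` row the HIGH-U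
  slab `[13/2, 17/2]` lies inside it, the LOW-U slab meets it exactly on `[5.82, 13/2]`, and the binding corner `U/t = 5` is below it.
* §4 THE THREE SLAB ENDS IN eV over the `t_eff` row: `5·t_eff ≤ 2.45 < 2.47` and `(17/2)·t_eff ≥ 3.23 > 3.2` are OUTSIDE the admitted `U` hull for EVERY `t_eff`
  (the two outer ends are R-ak's outward-print padding, cf. unc-2's `ndNiO2E_UoverT_slack` `2/49` / `3/38`), while the split `13/2` maps the whole `t_eff` row
  INTO the hull (`(13/2)·0.38 = 2.47` exactly, `(13/2)·0.49 = 3.185`).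

Everything is PROVED (theorems only; no `sorry`). HONEST FRAMING: containment / disjointness ARITHMETIC of SYSTEMATIC (screening-grade) boxes and of a route's
statement cell; no word, hull, box, bar or truth is created or edited; every literature number is [float] at source (the typed rationals are the PRINTED values);
nothing here bears on the route's cruxes except to say WHICH object they quantify over (object E, outside 𝒟, disjoint from object M and from S2 cell #1);
nothing about superconductivity in NdNiO₂ (M21's truth «known-nonSC» is a VALIDATION-SET label — PLD/CaH₂-capped class; MBE/atomic-H-capped films show
partial onsets 5–11 K without R = 0, Parzyck 2025 — not an input); no summit statement is proved by this file.
-/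

namespace Summit.Ventures.CertifiedManyBodySolver.Downfold

open NonemptyInterval

/-! ## §1 One `U` ladder, two objects — the bridge -/

/-- **THE BRIDGE**: the claimed enclosure of the object-M entry `ndNiO2M_Uabs` IS unc-2's one-band hull of record `ndNiO2_oneBandU_hull = [247/100, 16/5]` —
one rational interval in the tree semantically, two names by object (§R-ac FOLD v1 row `U_abs`). [folklore] -/
theorem ndNiO2M_Uabs_encl_eq_oneBandU_hull : ndNiO2M_Uabs.encl = ndNiO2_oneBandU_hull :=
  NonemptyInterval.ext
    (Prod.ext (by rw [ndNiO2M_Uabs, Entry.encl_ofEnds_fst, ndNiO2_oneBandU_hull])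
      (by rw [ndNiO2M_Uabs, Entry.encl_ofEnds_snd, ndNiO2_oneBandU_hull]))

/-- Real membership agrees under the two names: `ndNiO2M_Uabs.Mem U ↔ U ∈ ndNiO2_oneBandU_hull.ratCast ℝ`. [folklore] -/
theorem ndNiO2M_Uabs_mem_iff_oneBandU (U : ℝ) : ndNiO2M_Uabs.Mem U ↔ U ∈ ndNiO2_oneBandU_hull.ratCast ℝ := by
  rw [Entry.Mem, ndNiO2M_Uabs_encl_eq_oneBandU_hull]

/-- **Every admitted one-band `U` member is a member of the object-M `U_abs` entry** — unc-2's v3 census (§U-MEMBERS (1)–(5) + R-me (c) line (6) `2.8` + R-mm (a)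
lines (7) `2.85`, (8) `2.88`; hull UNCHANGED `[2.47, 3.2]`), by their `ndNiO2_oneBandU_members_v3_subset_hull` and the bridge — no member is re-typed here. [folklore] -/
theorem ndNiO2M_Uabs_mem_of_member_v3 {m : ℚ} (hm : m ∈ ndNiO2_oneBandU_members_v3) : ndNiO2M_Uabs.Mem (m : ℝ) := by
  have h := ndNiO2_oneBandU_members_v3_subset_hull.1 m hm
  rw [ndNiO2M_Uabs_mem_iff_oneBandU]
  exact mem_ratCast_iff.2 ⟨by exact_mod_cast h.1, by exact_mod_cast h.2⟩

/-- The object-M quotient ladder is monotone at the `U/t` rung too: direct row `[6.25, 8.68]` ⊆ ROW OF RECORD `[5.82, 9.8]`. [folklore] -/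
theorem ndNiO2M_UoverT_direct_sub_row : ∀ x, ndNiO2M_UoverT_direct.Mem x → ndNiO2M_UoverT.Mem x :=
  fun _ hx => Entry.mem_ofEnds_mono (by norm_num) (by norm_num) hx

/-- **ONE ADMITTED `U` MEMBER, TWO TYPED QUOTIENT ROWS — each under its own object's hopping scale**: for every v3 member `m`, `m / t_M ∈ U/t (M)` ROW
`[5.82, 9.8]` for every `t_M` in the MLWF direct hull `[0.3689, 0.395]` eV (this lane's `ndNiO2M_UoverT_direct_of_mem`), and `m / t_E ∈ U/t (E)` `[5, 17/2]` for
every `t_E` in the `t_eff` row `[0.38, 0.49]` eV (unc-2's `ndNiO2E_M21_U_mem_of_member_v3_div`). The same eV number reads as two different dimensionless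
couplings because the two objects carry different `t` (MLWF `t` vs the `t–t′` refit `t_eff`). [folklore] -/
theorem ndNiO2_oneBandU_member_mem_both_UoverT_rows {m : ℚ} (hm : m ∈ ndNiO2_oneBandU_members_v3) {tM tE : ℝ}
    (htM : ndNiO2M_t_direct.Mem tM) (htE : ndNiO2E_M21_t.Mem tE) :
    ndNiO2M_UoverT.Mem ((m : ℝ) / tM) ∧ ndNiO2E_M21_U.Mem ((m : ℝ) / tE) :=
  ⟨ndNiO2M_UoverT_direct_sub_row _ (ndNiO2M_UoverT_direct_of_mem (ndNiO2M_Uabs_mem_of_member_v3 hm) htM),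
    (ndNiO2E_M21_U_mem_of_member_v3_div hm htE).1⟩

/-- **Worked member: Kitatani 2020's `U = 3.2` eV** (§U-MEMBERS (3), the hull's high EDGE member) over its OWN printed `t = 0.395` eV reads `U/t = 640/79 ≈ 8.10`
in object M, and over the `t_eff` row reads `U/t_eff ∈ [320/49, 160/19] ≈ [6.53, 8.42]` in object E — inside both typed rows; the paper's own «U = 8t» uses
`t = 0.395` rounded (`8 × 0.395 = 3.16`). [folklore] -/
theorem ndNiO2_Kitatani_U_two_readings :
    ((291/50 : ℚ) ≤ (16/5) / (395/1000) ∧ (16/5 : ℚ) / (395/1000) = 640/79 ∧ (640/79 : ℚ) ≤ 49/5) ∧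
      ((5 : ℚ) ≤ (16/5) / (49/100) ∧ (16/5 : ℚ) / (49/100) = 320/49 ∧ (16/5 : ℚ) / (19/50) = 160/19 ∧ (160/19 : ℚ) ≤ 17/2) ∧
      (8 * (395/1000 : ℚ) = 79/25 ∧ (79/25 : ℚ) < 16/5) := by
  refine ⟨?_, ?_, ?_⟩ <;> norm_num

/-! ## §2 The two-object table of column M21 (box #20), rows by value -/

/-- **Object E vs object M on column M21, rows by value** (`boxNdNiO2E_M21` / `boxNdNiO2M_M21`): `U/t` `[5, 17/2]` vs `[291/50, 49/5]` overlap `[291/50, 17/2]`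
(E reaches lower, M higher); `t` (eV) `[19/50, 49/100]` vs `[8/25, 433/1000]` overlap `[19/50, 433/1000]`; `t′/t` `[−23/50, −9/25]` vs `[−321/1000, −4/25]`
DISJOINT (gap `39/1000`); `t″/t` `{0}` vs `[33/500, 167/1000]` DISJOINT; the filling entry is ONE decl (`boxNdNiO2_M21_filling_shared`). [folklore] -/
theorem ndNiO2_M21_objects_rows_arith :
    Set.Icc (5 : ℚ) (17/2) ∩ Set.Icc (291/50) (49/5) = Set.Icc (291/50) (17/2) ∧
      Set.Icc (19/50 : ℚ) (49/100) ∩ Set.Icc (8/25) (433/1000) = Set.Icc (19/50) (433/1000) ∧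
      Set.Icc (-23/50 : ℚ) (-9/25) ∩ Set.Icc (-321/1000) (-4/25) = ∅ ∧ ((-321/1000 : ℚ) - (-9/25) = 39/1000) ∧
      Set.Icc (0 : ℚ) 0 ∩ Set.Icc (33/500) (167/1000) = ∅ ∧
      boxNdNiO2E_M21 .filling = boxNdNiO2M_M21 .filling := by
  refine ⟨?_, ?_, ?_, by norm_num, ?_, boxNdNiO2_M21_filling_shared⟩
  · rw [Set.Icc_inter_Icc]; congr 1 <;> norm_num
  · rw [Set.Icc_inter_Icc]; congr 1 <;> norm_num
  · rw [Set.Icc_inter_Icc, Set.Icc_eq_empty]; norm_num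
  · rw [Set.Icc_inter_Icc, Set.Icc_eq_empty]; norm_num

/-- **§OF-RECORD v1.1 «object E is DISJOINT in tp/t», typed: as nine-coordinate boxes `boxNdNiO2E_M21 ∩ boxNdNiO2M_M21 = ∅`** — no parameter vector lies in both
(the `t′/t` rows do not meet; nor do the `t″/t` rows: object E is the `t–t′` refit with `t″ = 0`, object M the MLWF Hamiltonian with `t″/t ≥ 0.066`). The two boxes
are two READINGS of one DFT band, never one product box (BOX-SCHEMA C9). [folklore] -/
theorem boxNdNiO2E_M21_boxNdNiO2M_M21_disjoint (p : OneBandCoord → ℝ) : ¬ (boxNdNiO2E_M21.Mem p ∧ boxNdNiO2M_M21.Mem p) := by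
  rintro ⟨hE, hM⟩
  have h1 := (Entry.mem_ofEnds_iff _ _ _ _ _).1 (hE .tpOverT ndNiO2E_M21_tp rfl)
  have h2 := (Entry.mem_ofEnds_iff _ _ _ _ _).1 (hM .tpOverT ndNiO2M_tp rfl)
  push_cast at h1 h2
  linarith [h1.2, h2.1]

/-- The same disjointness read on the `t″/t` coordinate alone (object E's point entry `0` vs object M's row `[33/500, 167/1000]`). [folklore] -/
theorem boxNdNiO2E_M21_boxNdNiO2M_M21_disjoint_tpp (p : OneBandCoord → ℝ) (hE : boxNdNiO2E_M21.Mem p) (hM : boxNdNiO2M_M21.Mem p) : False := by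
  have h1 := (Entry.mem_ofEnds_iff _ _ _ _ _).1 (hE .tppOverT ndNiO2E_M21_tpp rfl)
  have h2 := (Entry.mem_ofEnds_iff _ _ _ _ _).1 (hM .tppOverT ndNiO2M_tpp rfl)
  push_cast at h1 h2
  linarith [h1.2, h2.1]

/-- **…while the `(U/t, n, t)` faces DO have common points**: e.g. `U/t = 7`, `t = 2/5` eV, any shared `n` (here `9/10`) lie in both objects' rows
(`[5, 17/2] ∩ [291/50, 49/5]`, `[19/50, 49/100] ∩ [8/25, 433/1000]`, `[213/250, 477/500]`) — so a statement keyed on `(U/t, n, t)` alone does not tell the objects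
apart; `t′/t` (and `t″/t`) does. [folklore] -/
theorem ndNiO2_M21_objects_common_threeFace_point :
    (ndNiO2E_M21_U.Mem 7 ∧ ndNiO2M_UoverT.Mem 7) ∧ (ndNiO2E_M21_t.Mem (2/5) ∧ ndNiO2M_t.Mem (2/5)) ∧ ndNiO2E_M21_n.Mem (9/10) := by
  refine ⟨⟨(Entry.mem_ofEnds_iff _ _ _ _ _).2 ⟨?_, ?_⟩, (Entry.mem_ofEnds_iff _ _ _ _ _).2 ⟨?_, ?_⟩⟩,
    ⟨(Entry.mem_ofEnds_iff _ _ _ _ _).2 ⟨?_, ?_⟩, (Entry.mem_ofEnds_iff _ _ _ _ _).2 ⟨?_, ?_⟩⟩,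
    (Entry.mem_ofEnds_iff _ _ _ _ _).2 ⟨?_, ?_⟩⟩ <;> norm_num

/-! ## §3 Where the residual cell of «CovNdNiO2M21» sits among the objects -/

/-- **The route cell is `t′/t`-DISJOINT from object M**: every point of unc-2's `boxNdNiO2E_M21res` (the residual corner cell `U/t ∈ [5, 17/2] × t′/t ∈ [−23/50, −11/25]
× n ∈ [9/10, 477/500]` of items stmt-Ventures-26751 / 26752) has `t′/t ≤ −11/25 < −321/1000`, so its `t′/t` is NOT in the object-M row `ndNiO2M_tp` — the cruxes
quantify over object-E parameters only; no object-M statement instantiates their `t′`. [folklore] -/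
theorem boxNdNiO2E_M21res_holdsOn_not_objectM_tp :
    HoldsOn (fun p : OneBandCoord → ℝ => ¬ ndNiO2M_tp.Mem (p .tpOverT)) boxNdNiO2E_M21res := by
  intro p hp hc
  have h1 := (Entry.mem_ofEnds_iff _ _ _ _ _).1 (hp .tpOverT ndNiO2E_M21res_tp rfl)
  have h2 := (Entry.mem_ofEnds_iff _ _ _ _ _).1 hc
  push_cast at h1 h2
  linarith [h1.2, h2.1]

/-- Hence no parameter vector lies in both the route cell and the object-M box of record. [folklore] -/
theorem boxNdNiO2E_M21res_boxNdNiO2M_M21_disjoint (p : OneBandCoord → ℝ) : ¬ (boxNdNiO2E_M21res.Mem p ∧ boxNdNiO2M_M21.Mem p) :=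
  fun h => boxNdNiO2E_M21res_holdsOn_not_objectM_tp p h.1 (h.2 .tpOverT ndNiO2M_tp rfl)

/-- **The route cell lies OUTSIDE hubbard-fast's solver domain 𝒟 (`|t′/t| ≤ 3/10`) by `0.14`**: every point has `t′/t ≤ −11/25 = −(3/10) − 7/50`, so
`¬ |t′/t| ≤ 3/10` (the S2 box-certificate machinery's `t′` range does not reach the cell; the obs route's apex-station theorems are the instrument). [folklore] -/
theorem boxNdNiO2E_M21res_holdsOn_outside_D :
    HoldsOn (fun p : OneBandCoord → ℝ => p .tpOverT ≤ -(3/10) - 7/50 ∧ ¬ |p .tpOverT| ≤ 3/10) boxNdNiO2E_M21res := by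
  intro p hp
  have h1 := (Entry.mem_ofEnds_iff _ _ _ _ _).1 (hp .tpOverT ndNiO2E_M21res_tp rfl)
  push_cast at h1
  refine ⟨by linarith [h1.2], fun habs => ?_⟩
  have h2 := (abs_le.1 habs).1
  linarith [h1.2]

/-- **The route cell is DISJOINT from hubbard-fast's S2 cell #1 on TWO faces** (`boxS2Cell1NdNiO2M` = cell #1 `[15/2, 17/2] × [−3/10, −1/5] × [173/200, 177/200]`
inside object M, this lane's §4): every point of the route cell has `t′/t ≤ −11/25 < −3/10` AND `n ≥ 9/10 > 177/200` — S2's cell-#1 words (which DO speak to the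
NdNiO₂ parent in object M, `boxS2Cell1NdNiO2M_refines_M21`) say nothing on the route cell, by `t′/t` and by filling independently; only the `U/t` faces meet
(`[15/2, 17/2] ⊂ [5, 17/2]`). [folklore] -/
theorem boxNdNiO2E_M21res_holdsOn_not_cell1_faces :
    HoldsOn (fun p : OneBandCoord → ℝ => ¬ s2Cell1La214E_tp.Mem (p .tpOverT) ∧ ¬ s2Cell1La214E_n.Mem (p .filling)) boxNdNiO2E_M21res := by
  intro p hp
  have h1 := (Entry.mem_ofEnds_iff _ _ _ _ _).1 (hp .tpOverT ndNiO2E_M21res_tp rfl)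
  have h2 := (Entry.mem_ofEnds_iff _ _ _ _ _).1 (hp .filling ndNiO2E_M21res_n rfl)
  push_cast at h1 h2
  refine ⟨fun hc => ?_, fun hc => ?_⟩
  · have h3 := (Entry.mem_ofEnds_iff _ _ _ _ _).1 hc
    push_cast at h3
    linarith [h1.2, h3.1]
  · have h3 := (Entry.mem_ofEnds_iff _ _ _ _ _).1 hc
    push_cast at h3
    linarith [h2.1, h3.2]

/-- Hence no parameter vector lies in both the route cell and the cell-#1 sub-box of object M; the `U/t` faces alone overlap (`[15/2, 17/2] ⊆ [5, 17/2]`). [folklore] -/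
theorem boxNdNiO2E_M21res_boxS2Cell1NdNiO2M_disjoint (p : OneBandCoord → ℝ) :
    ¬ (boxNdNiO2E_M21res.Mem p ∧ boxS2Cell1NdNiO2M.Mem p) ∧ Set.Icc (15/2 : ℚ) (17/2) ⊆ Set.Icc 5 (17/2) :=
  ⟨fun h => (boxNdNiO2E_M21res_holdsOn_not_cell1_faces p h.1).2 (h.2 .filling s2Cell1La214E_n boxS2Cell1NdNiO2M_n),
    Set.Icc_subset_Icc (by norm_num) le_rfl⟩

/-- **The route's two `U`-slabs against the object-M `U/t` ROW `[5.82, 9.8]`**: the HIGH-U slab `[13/2, 17/2]` (stmt-Ventures-26752) lies INSIDE the row; the LOW-U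
slab `[5, 13/2]` (stmt-Ventures-26751) meets it exactly on `[291/50, 13/2]`; the binding corner `U/t = 5` is NOT in the row (`5 < 291/50`): in the MLWF-plus-`t″`
language the parent's `U/t` never reaches the route's binding corner — that corner is an object-E coupling (`2.47 / 0.49` printed outward, R-ak). [folklore] -/
theorem ndNiO2M_UoverT_vs_routeSlabs :
    (∀ U ∈ Set.Icc (13/2 : ℝ) (17/2), ndNiO2M_UoverT.Mem U) ∧
      (∀ U ∈ Set.Icc (5 : ℝ) (13/2), ndNiO2M_UoverT.Mem U ↔ (291/50 : ℝ) ≤ U) ∧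
      ¬ ndNiO2M_UoverT.Mem 5 ∧ Set.Icc (5 : ℚ) (13/2) ∩ Set.Icc (291/50) (49/5) = Set.Icc (291/50) (13/2) := by
  refine ⟨fun U hU => ?_, fun U hU => ?_, fun h5 => ?_, ?_⟩
  · refine (Entry.mem_ofEnds_iff _ _ _ _ _).2 ⟨?_, ?_⟩ <;> push_cast <;> linarith [hU.1, hU.2]
  · rw [ndNiO2M_UoverT, Entry.mem_ofEnds_iff]; push_cast
    exact ⟨fun h => h.1, fun h => ⟨h, by linarith [hU.2]⟩⟩
  · have h := ((Entry.mem_ofEnds_iff _ _ _ _ _).1 h5).1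
    push_cast at h
    linarith
  · rw [Set.Icc_inter_Icc]; congr 1 <;> norm_num

/-! ## §4 The three slab ends `5`, `13/2`, `17/2` in eV over the `t_eff` row `[0.38, 0.49]` -/

/-- **THE THREE SLAB ENDS IN eV.** Over EVERY `t_eff` of the typed row `[19/50, 49/100]` eV: the binding corner `U/t_eff = 5` gives `U = 5·t_eff ∈ [1.9, 2.45]` eV —
BELOW the admitted one-band hull `[2.47, 3.2]` (`2.45 < 2.47`: no admitted `(U, t_eff)` pair realises the corner; it is R-ak's outward-print padding `2/49` in `U/t`,
unc-2's `ndNiO2E_UoverT_slack`); the top `U/t_eff = 17/2` gives `U ∈ [3.23, 4.165]` eV — ABOVE the hull (padding `3/38`); the captain's split `13/2` maps the WHOLE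
`t_eff` row INTO the hull: `(13/2)·(19/50) = 247/100` exactly (the in-house cRPA(W) 26-Ry low edge) and `(13/2)·(49/100) = 637/200 = 3.185 ≤ 3.2`. [folklore] -/
theorem ndNiO2_M21_slabEnds_eV {t : ℝ} (ht : ndNiO2E_M21_t.Mem t) :
    ¬ ndNiO2M_Uabs.Mem (5 * t) ∧ ¬ ndNiO2M_Uabs.Mem (17/2 * t) ∧ ndNiO2M_Uabs.Mem (13/2 * t) := by
  have ht' := (Entry.mem_ofEnds_iff _ _ _ _ _).1 ht
  push_cast at ht'
  refine ⟨fun h => ?_, fun h => ?_, ?_⟩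
  · have h' := ((Entry.mem_ofEnds_iff _ _ _ _ _).1 h).1
    push_cast at h'
    linarith [ht'.2]
  · have h' := ((Entry.mem_ofEnds_iff _ _ _ _ _).1 h).2
    push_cast at h'
    linarith [ht'.1]
  · refine (Entry.mem_ofEnds_iff _ _ _ _ _).2 ⟨?_, ?_⟩ <;> push_cast <;> linarith [ht'.1, ht'.2]

/-- The four eV literals of `ndNiO2_M21_slabEnds_eV` ARE products of the typed ends (no hidden constant): `5·(19/50) = 19/10`, `5·(49/100) = 49/20 < 247/100`
(short by `1/50` eV), `(17/2)·(19/50) = 323/100 > 16/5` (over by `3/100` eV), `(13/2)·(19/50) = 247/100`, `(13/2)·(49/100) = 637/200 ≤ 16/5`; and `13/2` is the LEAST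
`U/t_eff` whose whole `t_eff`-fibre is admitted (`u·(19/50) ≥ 247/100 ↔ u ≥ 13/2`), the largest being `16/5 ÷ 49/100 = 320/49 ≈ 6.53`. [folklore] -/
theorem ndNiO2_M21_slabEnds_eV_literals :
    (5 * (19/50 : ℚ) = 19/10 ∧ 5 * (49/100 : ℚ) = 49/20 ∧ (247/100 : ℚ) - 49/20 = 1/50) ∧
      ((17/2) * (19/50 : ℚ) = 323/100 ∧ (323/100 : ℚ) - 16/5 = 3/100) ∧
      ((13/2) * (19/50 : ℚ) = 247/100 ∧ (13/2) * (49/100 : ℚ) = 637/200 ∧ (637/200 : ℚ) ≤ 16/5) ∧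
      (∀ u : ℚ, 247/100 ≤ u * (19/50) ↔ 13/2 ≤ u) ∧ ((16/5 : ℚ) / (49/100) = 320/49 ∧ (13/2 : ℚ) < 320/49) := by
  refine ⟨by norm_num, by norm_num, by norm_num, fun u => ?_, by norm_num⟩
  constructor <;> intro h <;> linarith

end Summit.Ventures.CertifiedManyBodySolver.Downfold
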